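import Mathlib
import Literature.Computability.MetaComplexity.GapMCSPLightConeLowerBound
import Literature.Computability.MetaComplexity.GapMKtPLightConeLowerBound
import Literature.Computability.MetaComplexity.ChenJinWilliams2019.SearchMagnification
import Literature.Computability.MetaComplexity.LevinKtUpperBounds
import HarnessLib

/-!
# The folklore sublinear lower bound for `search-MCSP[s]` and `search-MKtP[p]` against general
circuits, in the output convention of Chen–Jin–Williams (FOCS 2019), Thm. 1.6 / §5

Chen–Jin–Williams [ChenJinWilliams2019, Thm. 1.6 item 1] magnify the hypothesis
"`search-MCSP[s(m)] ∉ Circuit[n · poly(s(m))]`" (`n = 2^m`, `m ≤ s(m) ≤ 2^{(1-Ω(1))m}`) to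
`⊕P, PP, PSPACE ⊄ P/poly`, and its `search-MKtP[p(n)]` twin ("Moreover" clause) to `EXP ⊄ P/poly`.
The tree types the solver side as `ChenJinWilliams2019.SearchMCSPSolvableAt 𝒞 s m` /
`SearchMKtPSolvableAt U 𝒞 p n` (D12, `SearchMagnification.lean`): a tuple of output functions, EACH
in the length-indexed function class `𝒞`, obeying the output convention of §5 — output `0` is the
indicator of the decision problem (PROVED there: `sliceFn_mem_of_searchMCSPSolvableAt`,
`sliceFn_MKtP_mem_of_searchMKtPSolvableAt`).  The source states no lower bound for the search
problems; the census (`MagnificationGapCensus.lean`, row R52) records the KNOWN side as T-ONLY.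

This file proves the folklore KNOWN side IN THE SAME MODEL, per output bit, from the light-cone /
fibre-counting bounds of `GapMCSPLightConeLowerBound.lean` and `GapMKtPLightConeLowerBound.lean`:

* `not_searchMCSPSolvableAt_of_circuitCount_lt` — at a single parameter `m ≥ 1`: if the number of
  `m`-variable functions of complexity `≤ s(m)` is below `2^{2^m − f(2^m) − 1}`, then
  `search-MCSP[s]` is NOT solved at `m` by output functions with `B₂`-circuits of `≤ f(2^m)` gates
  (output `0` would be a `B₂`-circuit of `≤ f(2^m)` gates solving `MCSP[s(m), s(m)]`, contradicting
  `two_pow_le_circuitCount_of_solvesPromise`);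
* `eventually_not_searchMCSPSolvableAt_sublinear` — for `0 ≤ β < β' < 1` and every `s` with
  eventually `s(m) ≤ ⌈2^{βm}⌉`: for ALL large `m`, `search-MCSP[s]` is not solved at `m` with
  `N − ⌈N^{β'}⌉` gates per output bit (`N = 2^m`) — an almost-everywhere failure, stronger than the
  negation of the a.e. solvability in Thm. 1.6's hypothesis;
* `SizeRegime.exists_eventually_le_noBound` + `searchMCSP_known_sublinear` — every `s` in the
  regime of Thm. 1.6 (`SizeRegime s`) qualifies: SOME `β₀ < 1` works for every `β' ∈ (β₀, 1)`;
* `not_searchMKtPSolvableAt_of_le`, `searchMKtP_known_sublinear`,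
  `eventually_not_searchMKtPSolvableAt_powThreshold` — the `search-MKtP[p]` twins (every universal
  machine `U`; the YES side needs `1^n ∈ MKtP[p]` eventually, automatic for `p = ⌊n^β⌋`, `β > 0`);
* `knownBudget_lt_searchBudget` — the two budgets never cross: `N − ⌈N^{β'}⌉ < N · s^k + k`
  whenever `1 ≤ s` and `1 ≤ N`.

So in the model of R52 item 1 the KNOWN per-output budget is `N − ⌈N^{β'}⌉` (every `β' < 1` close
to `1`), the NEEDED one `N · s(m)^k + k` for EVERY `k`: the gap is the factor `poly(s(m))` — at the
census's `s√(m) = 2^{⌊√m⌋+1}` that is `N^{O(k/√log N)}` for each `k`.  Nothing here is a named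
fact; no statement of the source is altered.

Sources.  [ChenJinWilliams2019] L. Chen, C. Jin, R. R. Williams, *Hardness magnification for all
sparse NP languages*, FOCS 2019, Thm. 1.6 and §5 (ECCC TR19-118 p. 5 L16–28, p. 17 L22–28: the
output convention).  [ChenJinWilliams2020] L. Chen, C. Jin, R. R. Williams, *Sharp threshold results
for computational complexity*, STOC 2020, p. 4 (held text p0004 L11, verbatim: "it is not hard to
establish an Ω(n)-size lower bound for MCSP[n^{o(1)}]"; an earlier revision's paraphrase ('a linear
lower bound is trivial') is NOT the paper's wording — it occurs in neither held text, STOC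
extraction or ECCC TR20-065 incl. footnotes — and is withdrawn; referee W-A213-1, typer2 W-A17-1).
[Jukna2012] S. Jukna, *Boolean Function Complexity*, Springer 2012, §1.2 (light cones / counting).
-/

namespace Literature.Computability.MetaComplexity.ChenJinWilliams2019

open Filter Topology
open Literature.Computability.Complexity
open Literature.Computability.MetaComplexity

/-! ### `search-MCSP[s]` -/

/-- **Single-parameter form.** If `m ≥ 1` and the number of `m`-variable functions of
`B₂`-complexity `≤ s(m)` (bounded by `(s+1)(16(m+s+1)²)^s(m+s+1)`, `s = s(m)`) is below
`2^{2^m − f(2^m) − 1}`, then `search-MCSP[s]` is not solved at `m` by tuples of functions with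
`B₂`-circuits of `≤ f(2^m)` gates: output `0` alone would solve `MCSP[s(m), s(m)]` at length `2^m`.
[folklore] -/
theorem not_searchMCSPSolvableAt_of_circuitCount_lt {s f : ℕ → ℕ} {m : ℕ} (hm : 1 ≤ m)
    (h : (s m + 1) * (16 * (m + s m + 1) ^ 2) ^ s m * (m + s m + 1) < 2 ^ (2 ^ m - f (2 ^ m) - 1)) :
    ¬ SearchMCSPSolvableAt (b2CircuitFns f) s m := by
  intro hS
  have h0 := sliceFn_mem_of_searchMCSPSolvableAt hS
  obtain ⟨E, ⟨hB, hsz⟩, hcomp⟩ := h0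
  -- output `0` solves the promise problem `MCSP[s, s]` at length `2^m`
  have hsol : E.SolvesPromise (gapMCSP s s) := by
    intro u
    have hu : E.eval u = (MCSPSize s).boolIndicator (List.ofFn u) := hcomp u
    refine ⟨fun hy => ?_, fun hn => ?_⟩
    · rw [hu]; exact (Set.mem_iff_boolIndicator _ _).1 hy
    · rw [hu]
      refine (Set.notMem_iff_boolIndicator _ _).1 fun hy => ?_
      obtain ⟨n, g, hw, hg⟩ := hn
      rw [hw] at hy
      exact absurd ((truthTable_mem_MCSPSize_iff s g).1 hy) (not_le.2 hg)
  -- YES witness: the projection to the first variable has complexity `0 ≤ s m`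
  have hf₀ : circuitSizeOver B2 (fun v : Fin m → Bool => v ⟨0, hm⟩) ≤ s m :=
    (circuitSizeOver_le_of_computes (f := fun v : Fin m → Bool => v ⟨0, hm⟩)
      (Circuit.input (⟨0, hm⟩ : Fin m)) (fun g hg => by cases hg) (fun _ => rfl)).trans (by simp)
  have key := two_pow_le_circuitCount_of_solvesPromise E hB hsol hf₀
  have hmono : 2 ^ (2 ^ m - f (2 ^ m) - 1) ≤ 2 ^ (2 ^ m - E.size - 1) :=
    Nat.pow_le_pow_right (by norm_num) (by omega)
  exact absurd (hmono.trans key) (not_le.2 h)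

/-- **`search-MCSP[s]` is not solved with `N − ⌈N^{β'}⌉` gates per output bit, at ANY large `m`**
(`N = 2^m`), whenever eventually `s(m) ≤ ⌈2^{βm}⌉` for some `0 ≤ β < β' < 1`. [folklore] -/
theorem eventually_not_searchMCSPSolvableAt_sublinear {s : ℕ → ℕ} {β β' : ℝ} (hβ : 0 ≤ β)
    (hββ' : β < β') (hβ'1 : β' < 1)
    (hs : ∀ᶠ m : ℕ in atTop, s m ≤ OliveiraPichSanthanam2019.noBound β m) :
    ∀ᶠ m : ℕ in atTop,
      ¬ SearchMCSPSolvableAt (b2CircuitFns fun N => N - ⌈(N : ℝ) ^ β'⌉₊) s m := by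
  filter_upwards [eventually_circuitCount_noBound_lt hβ hββ' hβ'1, hs, eventually_ge_atTop 1]
    with m hm hsm hm1
  exact not_searchMCSPSolvableAt_of_circuitCount_lt hm1 ((circuitCount_mono m hsm).trans_lt hm)

/-- Every size function in the regime of Thm. 1.6 (`m ≤ s(m) ≤ 2^{cm}` eventually, `c < 1`) is
eventually below `⌈2^{βm}⌉` for some `β ∈ [0, 1)`. [cite: ChenJinWilliams2019, Thm. 1.6 (hypothesis on s)] -/
theorem SizeRegime.exists_eventually_le_noBound {s : ℕ → ℕ} (hs : SizeRegime s) :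
    ∃ β : ℝ, 0 ≤ β ∧ β < 1 ∧ ∀ᶠ m : ℕ in atTop, s m ≤ OliveiraPichSanthanam2019.noBound β m := by
  obtain ⟨c, hc1, hev⟩ := hs.2
  refine ⟨max c 0, le_max_right _ _, max_lt hc1 one_pos, ?_⟩
  filter_upwards [hev] with m hm
  have h2 : (2 : ℝ) ^ (c * m) ≤ (2 : ℝ) ^ (max c 0 * m) :=
    Real.rpow_le_rpow_of_exponent_le (by norm_num)
      (mul_le_mul_of_nonneg_right (le_max_left _ _) (Nat.cast_nonneg _))
  unfold OliveiraPichSanthanam2019.noBound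
  exact_mod_cast (hm.trans h2).trans (Nat.le_ceil _)

/-- **R52 item 1, the KNOWN side in the same model.** For every `s` in the regime of Thm. 1.6 there
is `β₀ < 1` such that for every `β' ∈ (β₀, 1)`, `search-MCSP[s]` is not solved with
`N − ⌈N^{β'}⌉` gates per output bit at any large `m`. Thm. 1.6 item 1 needs the budget
`N · s(m)^k + k` for EVERY `k`. [cite: ChenJinWilliams2019, Thm. 1.6 item 1 (hypothesis shape; known side folklore)] -/
theorem searchMCSP_known_sublinear {s : ℕ → ℕ} (hs : SizeRegime s) :
    ∃ β₀ : ℝ, β₀ < 1 ∧ ∀ β' : ℝ, β₀ < β' → β' < 1 → ∀ᶠ m : ℕ in atTop,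
      ¬ SearchMCSPSolvableAt (b2CircuitFns fun N => N - ⌈(N : ℝ) ^ β'⌉₊) s m := by
  obtain ⟨β, hβ0, hβ1, hev⟩ := hs.exists_eventually_le_noBound
  exact ⟨β, hβ1, fun β' hββ' hβ'1 => eventually_not_searchMCSPSolvableAt_sublinear hβ0 hββ' hβ'1 hev⟩

/-- The KNOWN and NEEDED budgets never cross: `N − ⌈N^{β'}⌉ < N · s^k + k` for `1 ≤ s`, `1 ≤ N`.
[folklore] -/
theorem knownBudget_lt_searchBudget {N s : ℕ} (hN : 1 ≤ N) (hs : 1 ≤ s) (k : ℕ) (β' : ℝ) :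
    N - ⌈(N : ℝ) ^ β'⌉₊ < N * s ^ k + k := by
  have h1 : 1 ≤ ⌈(N : ℝ) ^ β'⌉₊ :=
    Nat.one_le_iff_ne_zero.2 (Nat.ceil_pos.2 (Real.rpow_pos_of_pos (by exact_mod_cast hN) _)).ne'
  have h2 : N ≤ N * s ^ k := Nat.le_mul_of_pos_right N (Nat.pow_pos hs)
  omega

/-! ### `search-MKtP[p]` -/

section MKtP

variable (U : UniversalMachine)

/-- **Single-length form.** If `1^n ∈ MKtP[p]` and `p(n) + f(n) + 2 ≤ n`, then `search-MKtP[p]` is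
not solved at length `n` by tuples of functions with `B₂`-circuits of `≤ f(n)` gates: output `0`
would solve `Gap-MKtP[p, p]` at length `n` with `≤ f(n)` gates, so at least `2^{n − f(n) − 1}` strings
of length `n` would have `Kt ≤ p(n)`, but fewer than `2^{p(n)+1}` do. [folklore] -/
theorem not_searchMKtPSolvableAt_of_le {p f : ℕ → ℕ} {n : ℕ} (hyes : ones n ∈ U.MKtP p)
    (h : p n + f n + 2 ≤ n) : ¬ SearchMKtPSolvableAt U (b2CircuitFns f) p n := by
  intro hS
  have h0 := sliceFn_MKtP_mem_of_searchMKtPSolvableAt U hS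
  obtain ⟨E, ⟨hB, hsz⟩, hcomp⟩ := h0
  have hsol : E.SolvesPromise (U.gapMKtP p p) := by
    intro u
    have hu : E.eval u = (U.MKtP p).boolIndicator (List.ofFn u) := hcomp u
    refine ⟨fun hy => ?_, fun hn => ?_⟩
    · rw [hu]; exact (Set.mem_iff_boolIndicator _ _).1 hy
    · rw [hu]
      refine (Set.notMem_iff_boolIndicator _ _).1 fun hy => ?_
      rw [UniversalMachine.mem_gapMKtP_no_iff] at hn
      exact absurd (lt_of_lt_of_le hn hy) (lt_irrefl _)
  have hz : List.ofFn (fun _ : Fin n => true) ∈ (U.gapMKtP p p).yes := by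
    rw [List.ofFn_const]; exact hyes
  have key := PromiseProblem.two_pow_le_ncard_not_mem_no (U.gapMKtP p p) E hB hsol hz
  have hlt := lt_of_le_of_lt key (U.ncard_not_mem_gapMKtP_no_lt p p n)
  have := (Nat.pow_lt_pow_iff_right (by norm_num)).1 hlt
  omega

/-- **`search-MKtP[p]`, KNOWN side in the same model.** For `p` in the regime of Thm. 1.6
(`KtRegime p`: `p(n) ≤ n^c` eventually, `c < 1`) whose YES side eventually contains `1^n`, there is
`β₀ < 1` such that for every `β' ∈ (β₀, 1)`, `search-MKtP[p]` is not solved with `N − ⌈N^{β'}⌉`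
gates per output bit at any large length. [cite: ChenJinWilliams2019, Thm. 1.6 item 1, Moreover clause (hypothesis shape; known side folklore)] -/
theorem searchMKtP_known_sublinear {p : ℕ → ℕ} (hp : KtRegime p)
    (hyes : ∀ᶠ n : ℕ in atTop, ones n ∈ U.MKtP p) :
    ∃ β₀ : ℝ, β₀ < 1 ∧ ∀ β' : ℝ, β₀ < β' → β' < 1 → ∀ᶠ n : ℕ in atTop,
      ¬ SearchMKtPSolvableAt U (b2CircuitFns fun N => N - ⌈(N : ℝ) ^ β'⌉₊) p n := by
  obtain ⟨c, hc1, hev⟩ := hp.2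
  refine ⟨max c 0, max_lt hc1 one_pos, fun β' hβ₀ hβ'1 => ?_⟩
  have hcβ' : c < β' := (le_max_left c 0).trans_lt hβ₀
  have hβ'0 : 0 < β' := (le_max_right c 0).trans_lt hβ₀
  filter_upwards [hev, hyes, eventually_powLogThreshold_add_le hcβ' hβ'0 hβ'1.le 0] with n hn hy hnum
  refine not_searchMKtPSolvableAt_of_le U hy ?_
  have hpn : p n ≤ UniversalMachine.powLogThreshold c 0 n := by
    refine (Nat.le_floor hn).trans ?_
    exact OliveiraPichSanthanam2019.powThreshold_le_powLogThreshold c 0 n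
  omega

/-- **The instance `p = ⌊n^β⌋`** (`0 < β < β' < 1`): `search-MKtP[n^β]` is not solved with
`N − ⌈N^{β'}⌉` gates per output bit at any large length — unconditionally, for every universal
machine (`1^n ∈ MKtP[n^β]` eventually, `LevinKtUpperBounds.lean`). [folklore] -/
theorem eventually_not_searchMKtPSolvableAt_powThreshold {β β' : ℝ} (hβ : 0 < β) (hββ' : β < β')
    (hβ'1 : β' < 1) :
    ∀ᶠ n : ℕ in atTop, ¬ SearchMKtPSolvableAt U (b2CircuitFns fun N => N - ⌈(N : ℝ) ^ β'⌉₊)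
      (UniversalMachine.powThreshold β) n := by
  obtain ⟨N₀, hN₀⟩ := U.eventually_ones_mem_MKtP_powThreshold hβ
  filter_upwards [eventually_ge_atTop N₀,
    eventually_powLogThreshold_add_le hββ' (hβ.trans hββ') hβ'1.le 0] with n hn hnum
  refine not_searchMKtPSolvableAt_of_le U (hN₀ n hn) ?_
  have := OliveiraPichSanthanam2019.powThreshold_le_powLogThreshold β 0 n
  omega

end MKtP

end Literature.Computability.MetaComplexity.ChenJinWilliams2019
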